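import Summits.BirchSwinnertonDyer.Rank1Residual.P2.CongruentNumberSilentEvenFiveSelmerEightAoki
import Summits.BirchSwinnertonDyer.Rank1Residual.P2.CongruentNumberSilentEvenFiveThetaCMDescent
import Summits.BirchSwinnertonDyer.Rank1Residual.P2.CongruentNumberSilentEvenFiveEnclosureDescent
import Literature.NumberTheory.EllipticCurves.CongruentNumberEvenFiveSelmerBoundSevenModEight
import HarnessLib

/-!
# Cell `bsd-monsky`: the WHOLE even-five two-prime family without a `2`-Selmer display —
# `ord_{s=1} L(E_{2pq}, s) = 1 ∧ BSD(E_{2pq}, 2)` for ALL primes `p ≡ 5 (mod 8)`, `q ≡ 3 (mod 4)` from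
# {one CM-point display, GZK}, the `2`-Selmer input discharged by the tree's complete `2`-descent

HONEST FRAMING (cell `bsd-monsky`, run/shared/lean/pub/bsd-monsky/; README §1): the cell's theorem is Theorem 1.1
on `𝒮⁻`; the whole-family statements are the consumer-door record (README §3); nothing is booked by this file.
So far every whole-family door displayed a `2`-Selmer fact on the half `𝒮⁺ = {(p/q) = +1}` — Monsky 1990
Cor. 5.15 (2′) (`h515`), Monsky's appendix to Heath-Brown 1994 (`hMe`) or Aoki 1999 Thm. 2.2 (`hAo`) — to get
`Ш(E_{2pq})[2^∞] = 0` from rank one (GZK). The bound `#Sel⁽²⁾(E_{2pq}/ℚ) ≤ 8` is now a tree theorem on the WHOLE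
family (`card_selmerGroup_two_le_eight_congruentNumberCurve_two_mul_five_mul`,
`CongruentNumberEvenFiveSelmerBoundSevenModEight.lean`: complete `2`-descent on Selmer classes, the places `p`,
`q`, `∞`, the good primes and — on the cell `(p/q) = +1`, `q ≡ 7 (mod 8)` only — the place `2`), and with rank one
`#Sel₂ ≤ 8` already forces `Ш[2^∞] = 0` (`primaryComponent_sha_two_eq_bot_of_card_selmerGroup_le_eight`: the
descent count `#Sel₂ = 2^{rk}·#E(ℚ)[2]·#Ш[2]`, Silverman X.4.2). Hence:

* `analyticRank_eq_one_and_bsdp_two_plus_descent (hTYZ) (hGZK)` — the half `𝒮⁺` from {TYZ §3 data, GZK} alone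
  (Rédei–Reichardt is a tree theorem; no Monsky, no Heath-Brown, no Aoki);
* **`analyticRank_eq_one_and_bsdp_two_of_cmPointGaloisData_descent (hCM) (hGZK)`** — `ord = 1 ∧ BSD₂` for ALL
  `p ≡ 5 (mod 8)`, `q ≡ 3 (mod 4)` from {`tyz_cmPointGaloisData`, GZK} (route B on `𝒮⁻`), and the consumer-door
  shape `forall_bsdp_two_congruentNumberCurve_two_mul_five_mul_of_cmPointGaloisData_descent`; the same from the
  split display `tyz_cmPointClassFieldData`;
* `forall_bsdp_two_congruentNumberCurve_two_mul_five_mul_of_autSystem_descent (hTYZ) (hGZK) (hSys⁷)` (route A on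
  `𝒮⁻`) and the genus-form twin.

CONDITIONAL on the displays named; nothing asserted; no mark moved.
[cite: TianYuanZhang2017, Thm. 1.2, §3.1, Prop. 3.2, Thm. 3.5, Thm. 3.6, Lemma 3.21] [cite: Tian2014, Thm. 2.8, Def. 2.7, Prop. 2.1]
[cite: SilvermanAEC2009, Prop. X.1.4, Example X.1.5, Prop. X.4.9, Thm. X.4.2] [cite: Miller2011LMS, Def. 1.1 (arXiv:1010.2431 p. 3)]
-/

noncomputable section

open scoped Classical

open WeierstrassCurve Literature.NumberTheory.EllipticCurves
  Literature.NumberTheory.EllipticCurves.Rank1Residual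
  Literature.NumberTheory.EllipticCurves.Rank1Residual.Typed
  Literature.NumberTheory.EllipticCurves.HeathBrown1994.Families
  Literature.NumberTheory.EllipticCurves.Monsky1990
  Literature.NumberTheory.EllipticCurves.TianYuanZhang2017
  Literature.NumberTheory.QuadraticFields.RedeiReichardt
  Literature.NumberTheory.QuadraticForms

set_option autoImplicit false

namespace Summit.BirchSwinnertonDyer.Rank1Residual.P2

open Conjectures Literature.NumberTheory.EllipticCurves.Tian2014 ThetaDescent

/-! ## §0 Rank one and `#Sel₂ ≤ 8` give `Ш[2^∞] = 0` -/

/-- **`rk E_N(ℚ) = 1`, `#Sel₂(E_N) ≤ 8 ⟹ Ш(E_N)[2^∞] = 0`** for `E_N : y² = x³ − N²x`: the descent count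
`#Sel₂ = 2^{rk}·#E(ℚ)[2]·#(Ш ⊓ H¹[2])` (Silverman X.4.2) with `#E_N(ℚ)[2] = 4` leaves `#(Ш ⊓ H¹[2]) ≤ 1`.
[cite: SilvermanAEC2009, Thm. X.4.2] -/
theorem primaryComponent_sha_two_eq_bot_of_card_selmerGroup_le_eight {N : ℕ} (hN : N ≠ 0)
    (hrank : haveI := isElliptic_congruentNumberCurve hN; (congruentNumberCurve N).mordellWeilRank = 1)
    (hsel : Nat.card ((congruentNumberCurve N).selmerGroup 2) ≤ 8) :
    haveI := isElliptic_congruentNumberCurve hN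
    AddCommGroup.primaryComponent (congruentNumberCurve N).sha 2 = ⊥ := by
  haveI := isElliptic_congruentNumberCurve hN
  haveI : Fact (Nat.Prime 2) := ⟨Nat.prime_two⟩
  have hsel' : Nat.card ((congruentNumberCurve N).selmerGroup ((2 : ℕ) : ℤ)) ≤ 8 := by
    simpa only [Nat.cast_ofNat] using hsel
  haveI : Finite ((congruentNumberCurve N).selmerGroup ((2 : ℕ) : ℤ)) :=
    (congruentNumberCurve N).finite_selmerGroup_holds (by norm_num)
  have hpos : 0 < Nat.card ((congruentNumberCurve N).selmerGroup ((2 : ℕ) : ℤ)) := Nat.card_pos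
  have hcard := (congruentNumberCurve N).natCard_selmerGroup_eq (n := 2) two_ne_zero
  rw [hrank, pow_one] at hcard
  have aux : ∀ {C T S : ℕ}, C = 2 * T * S → T = 4 → 0 < C → C ≤ 8 → S = 1 := by
    intro C T S hC hT h0 h8
    subst hT; subst hC
    omega
  have hone := aux hcard (by convert Smith2016.natCard_torsionBy_two_congruentNumberCurve hN; norm_num) hpos hsel'
  exact primaryComponent_sha_eq_bot_of_inf_torsionBy_eq_bot (congruentNumberCurve N) 2
    (AddSubgroup.eq_bot_of_card_eq _ hone)

/-- **`#Sel₂(E_{2pq}) ≤ 8` for ALL primes `p ≡ 5 (mod 8)`, `q ≡ 3 (mod 4)`** (binder shape; the tree's complete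
`2`-descent, all four cells). [cite: SilvermanAEC2009, Prop. X.1.4, Example X.1.5, Prop. X.4.9] -/
theorem selmer_le_eight_evenFive :
    ∀ p q : ℕ, p.Prime → q.Prime → p % 8 = 5 → q % 4 = 3 →
      Nat.card ((congruentNumberCurve (2 * (p * q))).selmerGroup 2) ≤ 8 :=
  fun _ _ hp hq hp5 hq4 => card_selmerGroup_two_le_eight_congruentNumberCurve_two_mul_five_mul hp hq hp5 hq4

/-! ## §1 The half `𝒮⁺` from {TYZ §3 data, GZK} alone -/

/-- **`ord_{s=1} L(E_{2pq}, s) = 1 ∧ BSD(E_{2pq}, 2)` on `𝒮⁺` from {`tyz_genusPointData`, GZK}** — TYZ's genus criterion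
(`Σ₂′(2pq)` odd on `(p/q) = +1`, Rédei–Reichardt a tree theorem) gives `𝓛(2pq)` odd and `ord = 1`, GZK gives rank one,
and the tree's `2`-descent bound gives `Ш[2^∞] = 0`; no Monsky 1990, no Heath-Brown 1994, no Aoki 1999. CONDITIONAL;
nothing asserted. [cite: TianYuanZhang2017, Thm. 1.2, Thm. 3.5 and §1 (1.1)] [cite: SilvermanAEC2009, Thm. X.4.2, Prop. X.4.9]
[cite: Miller2011LMS, Def. 1.1 (arXiv:1010.2431 p. 3)] -/
theorem analyticRank_eq_one_and_bsdp_two_plus_descent (hTYZ : tyz_genusPointData)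
    (hGZK : rank_eq_analyticRank_of_analyticRank_le_one) {p q : ℕ} (hp : p.Prime) (hq : q.Prime)
    (hp5 : p % 8 = 5) (hq4 : q % 4 = 3) (hj : jacobiSym p q = 1) :
    (congruentNumberCurve (2 * (p * q))).analyticRank = 1 ∧ BSDp (congruentNumberCurve (2 * (p * q))) 2 := by
  have hp2 : p ≠ 2 := by omega
  have hq2 : q ≠ 2 := by omega
  have hne : p ≠ q := fun h => by omega
  obtain ⟨hN, -, -, -⟩ := isCor515Family_two_mul_five_mul hp hq hp5 hq4
  haveI := isElliptic_congruentNumberCurve hN.ne_zero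
  haveI : Fact (Nat.Prime 2) := ⟨Nat.prime_two⟩
  have hsq : Squarefree (2 * (p * q)) := hN.squarefree
  have h6 : (2 * (p * q)) % 8 = 6 := two_mul_five_mul_mod_eight hp5 hq4
  obtain ⟨Lz, hLodd, hr1, hderiv⟩ := rankOneDatum_of_uPlus_six (uPlus_of_genusPointData hTYZ hGZK) hsq h6
    (odd_genusSum₂'_genusField_two_mul_five_mul redeiReichardt_fourTwoCard_classGroup_holds hp hq hp5 hq4 hj)
  have hx : deriv (congruentNumberCurve (2 * (p * q))).entireLFunction 1 =
      (((2 : ℚ) ^ twoExponent (2 * (p * q)) * (Lz : ℚ) ^ 2 : ℚ) : ℂ) *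
        ((congruentNumberCurve (2 * (p * q))).realPeriodRat : ℂ) *
          ((congruentNumberCurve (2 * (p * q))).regulator : ℂ) := by
    rw [hderiv]; push_cast; ring
  have hx0 : (2 : ℚ) ^ twoExponent (2 * (p * q)) * (Lz : ℚ) ^ 2 ≠ 0 := by
    have hL0' : Lz ≠ 0 := fun h => by simp [h] at hLodd
    have hL0 : (Lz : ℚ) ≠ 0 := by exact_mod_cast hL0'
    exact mul_ne_zero (zpow_ne_zero _ two_ne_zero) (pow_ne_zero _ hL0)
  obtain ⟨hrank, -⟩ := hGZK (congruentNumberCurve (2 * (p * q))) (le_of_eq hr1)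
  rw [hr1] at hrank
  have hbot := primaryComponent_sha_two_eq_bot_of_card_selmerGroup_le_eight hN.ne_zero hrank
    (card_selmerGroup_two_le_eight_congruentNumberCurve_two_mul_five_mul hp hq hp5 hq4)
  obtain ⟨he, htam⟩ := twoExponent_tamagawa_two_mul_prime_mul hp hq hp2 hq2 hne
  obtain ⟨-, hiff⟩ := bsdp_two_congruentNumberCurve_iff_of_rank_one_of_sha_two_eq_bot hN hrank hbot
    (torsionOrder_congruentNumberCurve hsq) hx0 hx
  refine ⟨hr1, hiff.mpr ?_⟩
  rw [padicValRat_two_zpow_mul_sq hLodd, he, htam, padicValNat.prime_pow]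
  norm_num

/-! ## §2 The whole even-five family from {one CM-point display, GZK} -/

/-- **`ord_{s=1} L(E_{2pq}, s) = 1 ∧ BSD(E_{2pq}, 2)` for ALL primes `p ≡ 5 (mod 8)`, `q ≡ 3 (mod 4)` from
{`tyz_cmPointGaloisData`, GZK}** — route B on `𝒮⁻` (display alone), §1 on `𝒮⁺`; no `2`-Selmer display anywhere.
CONDITIONAL; nothing asserted. [cite: TianYuanZhang2017, Thm. 1.2, §3.1, Thm. 3.5, Thm. 3.6, Lemma 3.21]
[cite: SilvermanAEC2009, Prop. X.1.4, Example X.1.5, Prop. X.4.9, Thm. X.4.2] [cite: Miller2011LMS, Def. 1.1 (arXiv:1010.2431 p. 3)] -/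
theorem analyticRank_eq_one_and_bsdp_two_of_cmPointGaloisData_descent (hCM : tyz_cmPointGaloisData)
    (hGZK : rank_eq_analyticRank_of_analyticRank_le_one) {p q : ℕ} (hp : p.Prime) (hq : q.Prime)
    (hp5 : p % 8 = 5) (hq4 : q % 4 = 3) :
    (congruentNumberCurve (2 * (p * q))).analyticRank = 1 ∧ BSDp (congruentNumberCurve (2 * (p * q))) 2 := by
  have hne : p ≠ q := fun h => by omega
  rcases jacobiSym.eq_one_or_neg_one (int_gcd_eq_one_of_primes hp hq hne) with hj | hj
  · exact analyticRank_eq_one_and_bsdp_two_plus_descent (tyz_genusPointData_of_cmPointGaloisData hCM) hGZK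
      hp hq hp5 hq4 hj
  · exact congruentSilentEvenFiveBSDTwo_of_cmPointGaloisData_descent hCM p q hp hq hp5 hq4 hj

/-- **`BSD(E_{2pq}, 2)` on the whole even-five family from {`tyz_cmPointGaloisData`, GZK}** (consumer-door shape).
CONDITIONAL; nothing asserted. [cite: TianYuanZhang2017, Thm. 1.2, Thm. 3.5, Prop. 3.2, Thm. 3.6]
[cite: SilvermanAEC2009, Prop. X.1.4, Prop. X.4.9] -/
theorem forall_bsdp_two_congruentNumberCurve_two_mul_five_mul_of_cmPointGaloisData_descent
    (hCM : tyz_cmPointGaloisData) (hGZK : rank_eq_analyticRank_of_analyticRank_le_one) :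
    ∀ p q : ℕ, p.Prime → q.Prime → p % 8 = 5 → q % 4 = 3 → BSDp (congruentNumberCurve (2 * (p * q))) 2 :=
  fun _ _ hp hq hp5 hq4 => (analyticRank_eq_one_and_bsdp_two_of_cmPointGaloisData_descent hCM hGZK hp hq hp5 hq4).2

/-- **The whole even-five family from {`tyz_cmPointClassFieldData`, GZK}** (the split display whose every conjunct is a
printed sentence). CONDITIONAL; nothing asserted. [cite: TianYuanZhang2017, Thm. 1.2, §3.1, Prop. 3.2, Thm. 3.5, Thm. 3.6, Lemma 3.21]
[cite: Cox2013, Theorem 6.1 (ii) and Theorem 9.18] [cite: SilvermanAEC2009, Prop. X.1.4, Prop. X.4.9] -/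
theorem analyticRank_eq_one_and_bsdp_two_of_cmPointClassFieldData_descent (hCF : tyz_cmPointClassFieldData)
    (hGZK : rank_eq_analyticRank_of_analyticRank_le_one) {p q : ℕ} (hp : p.Prime) (hq : q.Prime)
    (hp5 : p % 8 = 5) (hq4 : q % 4 = 3) :
    (congruentNumberCurve (2 * (p * q))).analyticRank = 1 ∧ BSDp (congruentNumberCurve (2 * (p * q))) 2 :=
  analyticRank_eq_one_and_bsdp_two_of_cmPointGaloisData_descent (tyz_cmPointGaloisData_of_cmPointClassFieldData hCF)
    hGZK hp hq hp5 hq4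

/-- **`BSD(E_{2pq}, 2)` on the whole even-five family from {`tyz_cmPointClassFieldData`, GZK}** (consumer-door shape).
CONDITIONAL; nothing asserted. [cite: TianYuanZhang2017, Thm. 1.2, §3.1, Prop. 3.2, Thm. 3.5, Thm. 3.6]
[cite: Cox2013, Theorem 6.1 (ii) and Theorem 9.18] [cite: SilvermanAEC2009, Prop. X.1.4, Prop. X.4.9] -/
theorem forall_bsdp_two_congruentNumberCurve_two_mul_five_mul_of_cmPointClassFieldData_descent
    (hCF : tyz_cmPointClassFieldData) (hGZK : rank_eq_analyticRank_of_analyticRank_le_one) :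
    ∀ p q : ℕ, p.Prime → q.Prime → p % 8 = 5 → q % 4 = 3 → BSDp (congruentNumberCurve (2 * (p * q))) 2 :=
  fun _ _ hp hq hp5 hq4 =>
    (analyticRank_eq_one_and_bsdp_two_of_cmPointClassFieldData_descent hCF hGZK hp hq hp5 hq4).2

/-! ## §3 The whole family through route A on `𝒮⁻` -/

/-- **`BSD(E_{2pq}, 2)` on the whole even-five family from {`tyz_genusPointData`, GZK, `hSys⁷`}** (route A's aut system
display on `𝒮⁻`, §1 on `𝒮⁺`); no `2`-Selmer display. CONDITIONAL; nothing asserted.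
[cite: TianYuanZhang2017, Thm. 1.2, Thm. 3.3, Thm. 3.5] [cite: Tian2014, Thm. 2.8 (J132), Def. 2.7, Prop. 2.1, J124–J126]
[cite: SilvermanAEC2009, Prop. X.1.4, Prop. X.4.9] [cite: Miller2011LMS, Def. 1.1] -/
theorem forall_bsdp_two_congruentNumberCurve_two_mul_five_mul_of_autSystem_descent (hTYZ : tyz_genusPointData)
    (hGZK : rank_eq_analyticRank_of_analyticRank_le_one) (hSys : tian2014_system_sMinus_aut) :
    ∀ p q : ℕ, p.Prime → q.Prime → p % 8 = 5 → q % 4 = 3 → BSDp (congruentNumberCurve (2 * (p * q))) 2 := by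
  intro p q hp hq hp5 hq4
  have hne : p ≠ q := fun h => by omega
  rcases jacobiSym.eq_one_or_neg_one (int_gcd_eq_one_of_primes hp hq hne) with hj | hj
  · exact (analyticRank_eq_one_and_bsdp_two_plus_descent hTYZ hGZK hp hq hp5 hq4 hj).2
  · exact (congruentSilentEvenFiveBSDTwo_of_autSystem_descent hSys p q hp hq hp5 hq4 hj).2

/-- **`BSD(E_{2pq}, 2)` on the whole even-five family from {`tyz_genusPointData`, GZK, `hSys′`}** (route A's genus-form
system display on `𝒮⁻`). CONDITIONAL; nothing asserted. [cite: TianYuanZhang2017, Thm. 1.2, Thm. 3.3, Thm. 3.5]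
[cite: Tian2014, Thm. 2.8 (arXiv:1210.8231 p0011 L25–L44)] [cite: SilvermanAEC2009, Prop. X.1.4, Prop. X.4.9] -/
theorem forall_bsdp_two_congruentNumberCurve_two_mul_five_mul_of_genusSystem_descent (hTYZ : tyz_genusPointData)
    (hGZK : rank_eq_analyticRank_of_analyticRank_le_one) (hSys : tian2014_system_sMinus_genus) :
    ∀ p q : ℕ, p.Prime → q.Prime → p % 8 = 5 → q % 4 = 3 → BSDp (congruentNumberCurve (2 * (p * q))) 2 := by
  intro p q hp hq hp5 hq4
  have hne : p ≠ q := fun h => by omega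
  rcases jacobiSym.eq_one_or_neg_one (int_gcd_eq_one_of_primes hp hq hne) with hj | hj
  · exact (analyticRank_eq_one_and_bsdp_two_plus_descent hTYZ hGZK hp hq hp5 hq4 hj).2
  · exact (congruentSilentEvenFiveBSDTwo_of_genusSystem_descent hSys p q hp hq hp5 hq4 hj).2

end Summit.BirchSwinnertonDyer.Rank1Residual.P2

end
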